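import Literature.NumberTheory.LFunctions.Zhang2022.RepairRplus

/-!
# Zhang (2022) §18-margin repair rung — barrier extension for B-multi (L-a.iii): FAR STRUCTURE OF BOUNDED
# VARIATION beyond the wall, the family `familyFarBV` (DECIDED BY THEOREM E-033, no slot)

Trunk T-ANT (NumberTheory/LFunctions). Y. Zhang, *Discrete mean estimates and the Landau–Siegel
zero*, arXiv:2211.02515v1 (2022) [Zhang2022LandauSiegel] — **an unrefereed manuscript under
adjudication. WHAT THIS IS NOT: nothing here asserts or denies its Theorems 1–2 or any analytic lemma;
no claim about Landau–Siegel zeros, about Parity, or about a repaired `Margin232` is made. The theorem below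
is a statement about the manuscript's discrete mean as architected (a sum over sampled zeros with the
displayed (A)-world hypothesis `Re ρ = ½`), not about zeros of `L`-functions.** Cell `landau-siegel` (rung
F-S3), sub-cell E (barrier extension), seat p4, stub S-E-p4-4 of `barrier/ASSIGNMENTS.md` v1.25 (writer
ls-barrier-plan, 18:22:29Z/18:30:46Z): «`familyFarBV` (RepairFarBV.lean) — (L-a.iii) far bounded-variation
structure (sup `≤ B`, total variation `≤ V`: the E-033 hypotheses VERBATIM from p457577 `tailInvisible_bv` /
p457806 `discMeanFlat_bv`) as a `DesignFamily` DECIDED BY THEOREM — no slot; verdict in the discrete-mean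
currency with `Re ρ = ½` displayed exactly as `familyFarPiece`; `familyFarBV_decided`, `rplus_farBV_decided`; C2:
a 1-Lipschitz `‖·‖ ≤ 1` far piece is BV ⇒ recovers the `familyFarPiece` verdict shape; C4: one far STEP (jump at
`z₀ = 3/2`) + one far PPE block witness». Extension protocol of `RepairRplus` (p455670).

## Class text of record (C1): B-multi KILL-CERT (B-multi/KILL-draft.md v2.4 96c2304f42278a63, §2), verbatim

«(L-a.iii) features at fixed z₀ ≥ 1 + ε₀ — any far structure of BOUNDED VARIATION on [1+ε₀, 2] (sup ≤ B, total
variation ≤ V: far jumps, non-vanishing cut-offs, steps, PPE blocks) — carried in the class for completeness,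
DECIDED invisible by THEOREM (E-033 = `tailInvisible_bv` p457577 + `discMeanFlat_bv` p457806; C-1 widening of
v1's «1-Lipschitz per block»)». Member of record: B-multi design multi-far-001 (bulk `ϰ(1, 5/2)`-shape on
`[0,1]` + a far block of height `½` on `[3/2, 2)` with sharp jumps at `3/2` and `2`).

## The family

* Design `d : FarBVData` = `(c′, δ, ε, B, V, g)`: shift parameter `c′` of `𝔠*`, lengths `P^{1+ε} < P^{1+δ}`,
  sup bound `B`, variation bound `V`, profile `g : ℝ → ℂ` used as the coefficient `χψ(n)·g(log n/log P)·n^{−ρ}`.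
* `InClass d` (membership; NO analytic hypothesis): `0 < ε < δ`, `0 ≤ B`, `0 ≤ V`, `‖g z‖ ≤ B` for all `z`,
  `eVariationOn g [1, 1+δ] ≤ V` — the hypotheses of `KnifeEdgeDiscMeanFlat.discMeanFlat_bv` VERBATIM (the
  KILL-CERT's `[1+ε₀, 2]` is the case `δ = 1`; variation is asked on the whole far range `[1, 1+δ]`, which
  contains `[1+ε, 1+δ]` — a bulk that is anything below the wall and any BV far structure qualify; no
  continuity, no Lipschitz condition, no vanishing anywhere).
* `Verdict d` (discrete-mean currency of p446527/p457806, (A)-hypothesis DISPLAYED, kind (b)): for all large `D`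
  and every real primitive `χ (mod D)`, IF every sampled zero has `Re ρ = ½`, then pushing the length from
  `P^{1+ε}` to `P^{1+δ}` gains nothing at main order —
  `¬ (P^{−ε/8}·(discMeanAbs(⌈P^{1+ε}⌉) + (B+V)²·discWeight) < |discMean(⌈P^{1+δ}⌉) − discMean(⌈P^{1+ε}⌉)|)`
  (`Repair.discMean/discMeanAbs/discWeight` of `RepairRplus`, the literal sub-expressions of the theorem).
* **`familyFarBV_decided`** = `KnifeEdgeDiscMeanFlat.discMeanFlat_bv` (E-033, p457806 ← `tailInvisible_bv`
  p457577 ← the Pólya–Vinogradov × Abel engine with sup + variation p457384) re-packaged: DECIDED BY THEOREM,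
  nothing displayed beyond the (A)-hypothesis; `rplus_farBV_decided : ClassDecided (Rplus ++ [familyFarBV])`.

## C2 and C4

* C2 (`familyFarPiece ⊆ familyFarBV`): a 1-Lipschitz profile with `‖g‖ ≤ 1` has variation `≤ δ` on `[1, 1+δ]`
  (`eVariationOn_Icc_le_of_lipschitzWith`, via `LipschitzOnWith.comp_eVariationOn_le` ∘ `MonotoneOn.eVariationOn_le`),
  so `(c′, δ, ε, g) ↦ (c′, δ, ε, 1, δ, g)` maps `familyFarPiece.InClass` into `familyFarBV.InClass`
  (`farPiece_toFarBV`) and the far-piece verdict IMPLIES the far-BV verdict of the image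
  (`farBV_verdict_of_farPiece_verdict`: the BV bound is the Lipschitz bound with `discWeight` weighted by
  `(1+δ)² ≥ 1`).
* C4 (members, modelled on multi-far-001): `farStep` = the far STEP `𝟙_{z ≥ 3/2}` (one jump at `z₀ = 3/2`;
  `B = V = 1`) and `farBlock` = the far PPE BLOCK `𝟙_{[3/2, 2)}` (multi-far-001's block up to its amplitude `½`;
  sharp jumps at `3/2` and `2`; `B = 1`, `V = 2`), each for every `0 < ε < δ` and every `c′`
  (`inClass_farStep`, `inClass_farBlock`); variation bounds by `eVariationOn_comp_monotone_Icc_le` (a Lipschitz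
  map of a monotone step function). Tightness is moot: the family carries NO slot (decided by theorem).

CURRENCY (C3(e)): discrete mean over the sampled zeros (sums over `Skeleton.idx χ` with weights `Re 𝔠*·Re ω`);
the only conditional input is the displayed (A)-world hypothesis `Re ρ = ½` (Prop. 2.2's output); no dictionary
/ main-term identification is used or claimed. Numerical certificates: none (structural).

## References

* Y. Zhang, arXiv:2211.02515v1 (2022), §2 (2.16)–(2.20) [p. 4–6], §4 p. 8, §7 (7.2) p.44, §8 Lemma 8.1.
  [cite: Zhang2022LandauSiegel, §2 (2.16)–(2.20); §7 (7.2); §8 Lemma 8.1]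
* H. L. Montgomery, R. C. Vaughan, *Multiplicative Number Theory I*, CUP (2007), Thm 9.18 (Pólya–Vinogradov).
  [cite: MontgomeryVaughan2007, Thm 9.18]
-/

noncomputable section

open Real Complex Set
open scoped NNReal ENNReal

namespace Literature.NumberTheory.LFunctions.Zhang2022

namespace Repair

/-! ### Variation bookkeeping: Lipschitz maps of monotone functions on an interval -/

/-- Total variation of `f ∘ m` on `[a,b]` for `f` `K`-Lipschitz and `m` monotone real: `≤ K·(m b − m a)`.
[folklore] -/
private theorem eVariationOn_comp_monotone_Icc_le {f : ℝ → ℂ} {K : ℝ≥0} (hf : LipschitzWith K f) {m : ℝ → ℝ}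
    (hm : Monotone m) {a b : ℝ} (hab : a ≤ b) :
    eVariationOn (f ∘ m) (Icc a b) ≤ ENNReal.ofReal (K * (m b - m a)) := by
  have h1 : eVariationOn (f ∘ m) (Icc a b) ≤ K * eVariationOn m (Icc a b) :=
    (hf.lipschitzOnWith (s := univ)).comp_eVariationOn_le (mapsTo_univ m _)
  have h2 : eVariationOn m (Icc a b) ≤ ENNReal.ofReal (m b - m a) := by
    have := (hm.monotoneOn (Icc a b)).eVariationOn_le (left_mem_Icc.2 hab) (right_mem_Icc.2 hab)
    rwa [Set.inter_self] at this
  calc eVariationOn (f ∘ m) (Icc a b) ≤ K * eVariationOn m (Icc a b) := h1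
    _ ≤ K * ENNReal.ofReal (m b - m a) := by gcongr
    _ = ENNReal.ofReal (K * (m b - m a)) := by
        rw [ENNReal.ofReal_mul K.coe_nonneg, ENNReal.ofReal_coe_nnreal]

/-- A `K`-Lipschitz profile has total variation `≤ K·(b − a)` on `[a,b]`. [folklore] -/
private theorem eVariationOn_Icc_le_of_lipschitzWith {g : ℝ → ℂ} {K : ℝ≥0} (hg : LipschitzWith K g) {a b : ℝ}
    (hab : a ≤ b) : eVariationOn g (Icc a b) ≤ ENNReal.ofReal (K * (b - a)) :=
  eVariationOn_comp_monotone_Icc_le (m := id) hg monotone_id hab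

/-! ### The family `familyFarBV` -/

/-- A far-BV design: shift `c′`, lengths `P^{1+ε} < P^{1+δ}`, sup bound `B`, variation bound `V`, profile `g`.
[cite: Zhang2022LandauSiegel, §2 (2.16)–(2.20); §7 (7.2)] -/
structure FarBVData where
  /-- shift parameter of `𝔠*` -/
  c' : ℝ
  /-- top exponent: length `P^{1+δ}` -/
  δ : ℝ
  /-- comparison exponent: length `P^{1+ε}` -/
  ε : ℝ
  /-- sup bound of the profile -/
  B : ℝ
  /-- total-variation bound of the profile on `[1, 1+δ]` -/
  V : ℝ
  /-- the profile on the logarithmic scale -/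
  g : ℝ → ℂ

/-- family «far structure of bounded variation, any length, discrete-mean currency» — the E-033 hypotheses
verbatim as membership, the (A)-hypothesis displayed in the verdict, NO slot.
[cite: Zhang2022LandauSiegel, §2 (2.16)–(2.20); §7 (7.2); §8 Lemma 8.1] -/
def familyFarBV : DesignFamily where
  Design := FarBVData
  InClass d := 0 < d.ε ∧ d.ε < d.δ ∧ 0 ≤ d.B ∧ 0 ≤ d.V ∧ (∀ z, ‖d.g z‖ ≤ d.B) ∧
    eVariationOn d.g (Icc 1 (1 + d.δ)) ≤ ENNReal.ofReal d.V
  Verdict d := Skeleton.ForAllLarge fun D _ χ =>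
    (∀ i ∈ Skeleton.idx χ, (i.2).re = 1 / 2) →
      ¬ (Skeleton.bigP D ^ (-(d.ε / 8)) *
            (discMeanAbs d.c' χ d.g ⌈Skeleton.bigP D ^ (1 + d.ε)⌉₊ + (d.B + d.V) ^ 2 * discWeight d.c' χ) <
          |discMean d.c' χ d.g ⌈Skeleton.bigP D ^ (1 + d.δ)⌉₊ - discMean d.c' χ d.g ⌈Skeleton.bigP D ^ (1 + d.ε)⌉₊|)

/-- **(L-a.iii) is decided, by THEOREM E-033** (`KnifeEdgeDiscMeanFlat.discMeanFlat_bv`, p457806): for every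
far-BV design, for all large `D` and every real primitive `χ`, under the displayed hypothesis `Re ρ = ½`, pushing
the length from `P^{1+ε}` to `P^{1+δ}` gains nothing at main order — whatever bounded-variation structure (jumps,
sharp cut-offs, steps, PPE blocks) the profile carries beyond the wall. [cite: Zhang2022LandauSiegel, §2 (2.16)–(2.20); §8 Lemma 8.1] -/
theorem familyFarBV_decided : familyFarBV.Decided := fun d h =>
  (KnifeEdgeDiscMeanFlat.discMeanFlat_bv d.c' h.1 h.2.1).mono fun _ _ _ _ _ hflat hA =>
    not_lt.2 (hflat hA d.g d.B d.V h.2.2.1 h.2.2.2.1 h.2.2.2.2.1 h.2.2.2.2.2)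

/-- Unbundled form (every hypothesis a binder). [cite: Zhang2022LandauSiegel, §2 (2.16)–(2.20); §8 Lemma 8.1] -/
theorem not_lengthGain_farBV (c' : ℝ) {δ ε B V : ℝ} {g : ℝ → ℂ} (hε : 0 < ε) (hεδ : ε < δ) (hB : 0 ≤ B)
    (hV : 0 ≤ V) (hgB : ∀ z, ‖g z‖ ≤ B) (hvar : eVariationOn g (Icc 1 (1 + δ)) ≤ ENNReal.ofReal V) :
    Skeleton.ForAllLarge fun D _ χ =>
      (∀ i ∈ Skeleton.idx χ, (i.2).re = 1 / 2) →
        ¬ (Skeleton.bigP D ^ (-(ε / 8)) *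
              (discMeanAbs c' χ g ⌈Skeleton.bigP D ^ (1 + ε)⌉₊ + (B + V) ^ 2 * discWeight c' χ) <
            |discMean c' χ g ⌈Skeleton.bigP D ^ (1 + δ)⌉₊ - discMean c' χ g ⌈Skeleton.bigP D ^ (1 + ε)⌉₊|) :=
  familyFarBV_decided ⟨c', δ, ε, B, V, g⟩ ⟨hε, hεδ, hB, hV, hgB, hvar⟩

/-- **`R⁺ ++ [far BV]` is decided.** [cite: Zhang2022LandauSiegel, §2 (2.32)–(2.33); §7 (7.2)] -/
theorem rplus_farBV_decided : ClassDecided (Rplus ++ [familyFarBV]) := rplus_extend familyFarBV_decided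

/-! ### C2 — the smooth far pieces of `R⁺` are far-BV designs, and their verdict is the stronger one -/

/-- The embedding `familyFarPiece → familyFarBV`: `(c′, δ, ε, g) ↦ (c′, δ, ε, B = 1, V = δ, g)`.
[cite: Zhang2022LandauSiegel, §7 (7.2)] -/
def farPieceToFarBV (p : ℝ × ℝ × ℝ × (ℝ → ℂ)) : FarBVData := ⟨p.1, p.2.1, p.2.2.1, 1, p.2.1, p.2.2.2⟩

/-- A 1-Lipschitz profile with `‖g‖ ≤ 1` and `0 < ε < δ` is a far-BV design with `B = 1`, `V = δ`.
[cite: Zhang2022LandauSiegel, §7 (7.2)] -/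
theorem farPiece_toFarBV (p : ℝ × ℝ × ℝ × (ℝ → ℂ)) (h : familyFarPiece.InClass p) :
    familyFarBV.InClass (farPieceToFarBV p) := by
  obtain ⟨hε, hεδ, hlip, hg1⟩ := h
  have hδ : 0 ≤ p.2.1 := by linarith
  have hv : eVariationOn p.2.2.2 (Icc 1 (1 + p.2.1)) ≤ ENNReal.ofReal p.2.1 := by
    have := eVariationOn_Icc_le_of_lipschitzWith hlip (a := 1) (b := 1 + p.2.1) (by linarith)
    simpa using this
  exact ⟨hε, hεδ, zero_le_one, hδ, hg1, hv⟩

/-- The total absolute weight is non-negative. [cite: Zhang2022LandauSiegel, §2 (2.15)–(2.16)] -/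
theorem discWeight_nonneg {D : ℕ} [NeZero D] (c' : ℝ) (χ : DirichletCharacter ℂ D) : 0 ≤ discWeight c' χ :=
  Finset.sum_nonneg fun _ _ => abs_nonneg _

/-- On the image of the embedding the far-BV verdict FOLLOWS from the far-piece verdict of `R⁺` (its bound is
the Lipschitz bound with `discWeight` weighted by `(1+δ)² ≥ 1`): the two families agree in shape and the smooth
one is the sharper. [cite: Zhang2022LandauSiegel, §2 (2.16)–(2.20); §8 Lemma 8.1] -/
theorem farBV_verdict_of_farPiece_verdict (p : ℝ × ℝ × ℝ × (ℝ → ℂ)) (hδ : 0 ≤ p.2.1)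
    (h : familyFarPiece.Verdict p) : familyFarBV.Verdict (farPieceToFarBV p) := by
  refine h.mono fun D _ χ _ _ hv hA hlt => hv hA (lt_of_le_of_lt ?_ hlt)
  have hw := discWeight_nonneg (D := D) p.1 χ
  have hP : 0 ≤ Skeleton.bigP D ^ (-(p.2.2.1 / 8)) := Real.rpow_nonneg (Real.exp_pos _).le _
  have h1 : discWeight p.1 χ ≤ (1 + p.2.1) ^ 2 * discWeight p.1 χ := by
    have : (1:ℝ) ≤ (1 + p.2.1) ^ 2 := by nlinarith
    nlinarith
  change Skeleton.bigP D ^ (-(p.2.2.1 / 8)) *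
      (discMeanAbs p.1 χ p.2.2.2 ⌈Skeleton.bigP D ^ (1 + p.2.2.1)⌉₊ + discWeight p.1 χ) ≤
    Skeleton.bigP D ^ (-(p.2.2.1 / 8)) *
      (discMeanAbs p.1 χ p.2.2.2 ⌈Skeleton.bigP D ^ (1 + p.2.2.1)⌉₊ + (1 + p.2.1) ^ 2 * discWeight p.1 χ)
  gcongr

/-! ### C4 — members: a far STEP and a far PPE BLOCK (the shapes of B-multi design multi-far-001) -/

/-- The monotone unit step at `c`: `0` below `c`, `1` from `c` on. [folklore] -/
def stepUp (c : ℝ) (z : ℝ) : ℝ := if z < c then 0 else 1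

/-- `stepUp c` is monotone. [folklore] -/
private theorem monotone_stepUp (c : ℝ) : Monotone (stepUp c) := by
  intro x y hxy
  unfold stepUp
  by_cases hx : x < c
  · rw [if_pos hx]; split_ifs <;> norm_num
  · have hy : ¬ y < c := fun h => hx (lt_of_le_of_lt hxy h)
    rw [if_neg hx, if_neg hy]

/-- `0 ≤ stepUp c z ≤ 1`. [folklore] -/
private theorem stepUp_mem (c z : ℝ) : stepUp c z ∈ Icc (0:ℝ) 1 := by
  unfold stepUp; split_ifs <;> constructor <;> norm_num

/-- **The far STEP** `𝟙_{z ≥ 3/2}`: coefficients switched on sharply at `n = P^{3/2}` (one jump at `z₀ = 3/2`,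
no continuity, no vanishing at the top). [cite: Zhang2022LandauSiegel, §7 (7.2) p.44] -/
def farStep (z : ℝ) : ℂ := ((stepUp (3 / 2) z : ℝ) : ℂ)

/-- `farStep = 𝟙_{z ≥ 3/2}`. [cite: Zhang2022LandauSiegel, §7 (7.2) p.44] -/
theorem farStep_eq (z : ℝ) : farStep z = if z < 3 / 2 then 0 else 1 := by
  unfold farStep stepUp; split_ifs <;> simp

/-- `‖farStep z‖ ≤ 1`. [cite: Zhang2022LandauSiegel, §7 (7.2) p.44] -/
theorem norm_farStep_le (z : ℝ) : ‖farStep z‖ ≤ 1 := by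
  rw [farStep_eq]; split_ifs <;> simp

/-- The far step has total variation `≤ 1` on every `[1, 1+δ]`. [cite: Zhang2022LandauSiegel, §7 (7.2) p.44] -/
theorem eVariationOn_farStep_le {δ : ℝ} (hδ : 0 ≤ δ) :
    eVariationOn farStep (Icc 1 (1 + δ)) ≤ ENNReal.ofReal 1 := by
  have h := eVariationOn_comp_monotone_Icc_le (f := fun x : ℝ => (x : ℂ)) (m := stepUp (3 / 2))
    Complex.isometry_ofReal.lipschitz (monotone_stepUp _) (a := 1) (b := 1 + δ) (by linarith)
  refine (le_of_eq_of_le rfl h).trans (ENNReal.ofReal_le_ofReal ?_)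
  have h1 := (stepUp_mem (3 / 2) (1 + δ)).2
  have h0 := (stepUp_mem (3 / 2) 1).1
  push_cast
  linarith

/-- **`farStep` is a far-BV design** for every `0 < ε < δ` and every `c′` (`B = V = 1`).
[cite: Zhang2022LandauSiegel, §7 (7.2) p.44] -/
theorem inClass_farStep (c' : ℝ) {δ ε : ℝ} (hε : 0 < ε) (hεδ : ε < δ) :
    familyFarBV.InClass ⟨c', δ, ε, 1, 1, farStep⟩ :=
  ⟨hε, hεδ, zero_le_one, zero_le_one, norm_farStep_le, eVariationOn_farStep_le (by linarith)⟩

/-- The two-step counter `𝟙_{z ≥ 3/2} + 𝟙_{z ≥ 2}` (monotone, values `0, 1, 2`). [folklore] -/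
def blockCount (z : ℝ) : ℝ := stepUp (3 / 2) z + stepUp 2 z

/-- The 1-Lipschitz hat `x ↦ 1 − |x − 1|` read in `ℂ` (`0 ↦ 0`, `1 ↦ 1`, `2 ↦ 0`). [folklore] -/
def blockHat (x : ℝ) : ℂ := ((1 - dist 1 x : ℝ) : ℂ)

/-- `blockHat` is Lipschitz (constant `1·(0+1)`). [folklore] -/
private theorem lipschitz_blockHat : LipschitzWith (1 * (0 + 1)) blockHat :=
  Complex.isometry_ofReal.lipschitz.comp ((LipschitzWith.const (1:ℝ)).sub (LipschitzWith.dist_right (1:ℝ)))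

/-- **The far PPE BLOCK** `𝟙_{[3/2, 2)}` (multi-far-001's far block up to its amplitude `½`): sharp jumps at
`3/2` and at `2`, constant in between. [cite: Zhang2022LandauSiegel, §7 (7.2) p.44] -/
def farBlock (z : ℝ) : ℂ := blockHat (blockCount z)

/-- `farBlock = 𝟙_{[3/2, 2)}`. [cite: Zhang2022LandauSiegel, §7 (7.2) p.44] -/
theorem farBlock_eq (z : ℝ) : farBlock z = if 3 / 2 ≤ z ∧ z < 2 then 1 else 0 := by
  unfold farBlock blockHat blockCount stepUp
  by_cases h1 : z < 3 / 2
  · have h2 : z < 2 := by linarith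
    rw [if_pos h1, if_pos h2, if_neg (fun h => (not_le.2 h1) h.1)]
    simp
  · by_cases h2 : z < 2
    · rw [if_neg h1, if_pos h2, if_pos ⟨not_lt.1 h1, h2⟩]
      simp
    · rw [if_neg h1, if_neg h2, if_neg (fun h => h2 h.2)]
      norm_num [Real.dist_eq]

/-- `‖farBlock z‖ ≤ 1`. [cite: Zhang2022LandauSiegel, §7 (7.2) p.44] -/
theorem norm_farBlock_le (z : ℝ) : ‖farBlock z‖ ≤ 1 := by
  rw [farBlock_eq]; split_ifs <;> simp

/-- The far block has total variation `≤ 2` on every `[1, 1+δ]`. [cite: Zhang2022LandauSiegel, §7 (7.2) p.44] -/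
theorem eVariationOn_farBlock_le {δ : ℝ} (hδ : 0 ≤ δ) :
    eVariationOn farBlock (Icc 1 (1 + δ)) ≤ ENNReal.ofReal 2 := by
  have hm : Monotone blockCount := (monotone_stepUp _).add (monotone_stepUp _)
  have h := eVariationOn_comp_monotone_Icc_le lipschitz_blockHat hm (a := 1) (b := 1 + δ) (by linarith)
  refine (le_of_eq_of_le rfl h).trans (ENNReal.ofReal_le_ofReal ?_)
  have h1 := (stepUp_mem (3 / 2) (1 + δ)).2
  have h2 := (stepUp_mem 2 (1 + δ)).2
  have h3 := (stepUp_mem (3 / 2) 1).1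
  have h4 := (stepUp_mem 2 1).1
  unfold blockCount
  push_cast
  nlinarith

/-- **`farBlock` is a far-BV design** for every `0 < ε < δ` and every `c′` (`B = 1`, `V = 2`).
[cite: Zhang2022LandauSiegel, §7 (7.2) p.44] -/
theorem inClass_farBlock (c' : ℝ) {δ ε : ℝ} (hε : 0 < ε) (hεδ : ε < δ) :
    familyFarBV.InClass ⟨c', δ, ε, 1, 2, farBlock⟩ :=
  ⟨hε, hεδ, zero_le_one, by norm_num, norm_farBlock_le, eVariationOn_farBlock_le (by linarith)⟩

/-- Both members at the lengths of multi-far-001 (`δ = 1`: top `P²`; comparison length `P^{5/4}`), and their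
verdicts. [cite: Zhang2022LandauSiegel, §7 (7.2) p.44; §8 Lemma 8.1] -/
theorem farBV_examples (c' : ℝ) :
    familyFarBV.InClass ⟨c', 1, 1 / 4, 1, 1, farStep⟩ ∧ familyFarBV.Verdict ⟨c', 1, 1 / 4, 1, 1, farStep⟩ ∧
      familyFarBV.InClass ⟨c', 1, 1 / 4, 1, 2, farBlock⟩ ∧ familyFarBV.Verdict ⟨c', 1, 1 / 4, 1, 2, farBlock⟩ :=
  have h1 := inClass_farStep c' (δ := 1) (ε := 1 / 4) (by norm_num) (by norm_num)
  have h2 := inClass_farBlock c' (δ := 1) (ε := 1 / 4) (by norm_num) (by norm_num)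
  ⟨h1, familyFarBV_decided _ h1, h2, familyFarBV_decided _ h2⟩

end Repair

end Literature.NumberTheory.LFunctions.Zhang2022
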